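import Mathlib
import HarnessLib
import HarnessLib.Audit
import Summits.ResolutionOfSingularities.Statement
import HarnessLib.Audit.Status.Attr

/-!
Route: AbhyankarShadows

# Route AbhyankarShadows — Teissier's programme after HOST 2026 — Abhyankar semivaluation shadows of
every valuation, toric transfer, then patch

OPEN-QUESTION HARVEST (operator A). Printed question: Teissier, arXiv:2311.12456 (= LNM 2313, 2023)
p.5, Conjecture (first printed as
Oberwolfach Report 13 (2016) 3214–3217 and as item 2) of the "remaining part of the program",
Teissier2014 = arXiv:1401.5204 §10 p.62):
a rational NON-Abhyankar valuation ν of a local domain R (rational rank r < dim R) is the limit of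
rational ABHYANKAR SEMIVALUATIONS ν_α on
quotients R/K_α of dimension r whose value semigroups are finitely generated pieces of the semigroup
of ν, and "for large enough α toric
embedded uniformizations of the valuation ν_α also uniformize ν"; its two printed companions Problem
B (tight extension to the completion,
p.6) and Problem C (p.6). Problem B was PROVED on 6 Aug 2026 (HOST2026 = arXiv:2607.11223, Thm 1.1,
any rank, excellent local domains),
whose abstract names exactly this application; the conjecture is now the isolated open core of the
toric programme. It suffices to show
X = LurelRational (target, rank 0): relative Zariski local uniformization for RATIONAL valuation
rings (residue field = k) of function fields
over ALGEBRAICALLY CLOSED fields k of characteristic p, reached as K1 ∧ K2 with K1 =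
SemivaluationShadows (crux 3, the existence half of
the conjecture in a finite-type, toric-free typing: for every finite F ⊆ R there is a shadow — a
k-algebra map φ from a local blowing up R₁
of R to a field carrying a rational valuation ring O' of the same rational rank, finitely generated
value semigroup on φ(R₁) embedded in
that of ν by an injective ordered hom ι of value groups, same centre, and ι ∘ ν' ∘ φ = ν on F) and
K2 = ShadowsUniformize (crux 2, the
transfer half: shadows for every finite F ⇒ a regular affine model dominating R; engine = Teissier's
overweight deformation of the shadow
to the toric variety of its semigroup + toric embedded uniformization, Teissier2014 Thm 4.3,
algebraised through HOST2026). Then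
RationalSuffices (support: rational valuation rings suffice over k̄ — the tree's
relLU_of_relLU_zeroDim), PatchingPerfect (crux 4, shared
VERBATIM with route IndSmooth), DescentAlgclosedToPerfect (crux 5, stmt-0550) and
DescentPerfectToAll (crux 6, stmt-0549). No card realised
(printed-question route); related cards named under Novelty.
Lean: `SemivaluationShadows ∧ ShadowsUniformize ∧ RationalSuffices ∧ PatchingPerfect ∧
DescentAlgclosedToPerfect ∧ DescentPerfectToAll`

## Assembly
Pure logic (sketch/Sketch.lean = glue.lean: lean check rc 0, 0 sorries): fix p prime;
DescentPerfectToAll p hp reduces ResolutionInChar p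
to reduced separated finite-type X over PERFECT k; DescentAlgclosedToPerfect p hp to ALGEBRAICALLY
CLOSED k (an instance of PerfectField);
PatchingPerfect p hp k reduces that to relative LU over k for all finitely generated K/k and all
valuation rings, which RationalSuffices p hp k
derives from the rational case, itself ShadowsUniformize applied to the shadows supplied by
SemivaluationShadows for every finite F:
`closes h1 h2 h3 hP hD1 hD2 := fun p hp => hD2 p hp (hD1 p hp (fun k _ _ _ X f hs hl hq hr => hP p
hp k (h3 p hp k (fun K _ _ hfg O hO hrat R
hR hRO => h2 p hp k K hfg O hO hrat R hR hRO (fun F => h1 p hp k K hfg O hO hrat R hR hRO F))) X f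
hs hl hq hr))`. Every crux and the support
are used; the route file needs nothing beyond Mathlib and the Statement's module.

Rationale: WHY THIS LINE. Mechanism: the graded algebra gr_ν R of a rational valuation is the semigroup algebra
k[t^Γ] of its value semigroup — binomial, blind to
the characteristic — and R is an OVERWEIGHT DEFORMATION of it (valuative Cohen theorem, Teissier2014
Thm 3.12); when Γ is finitely generated
one regular fan uniformizes ν (Thm 4.3) and this is how Abhyankar valuations are uniformized in
every characteristic (Thm 6.21, Cor 6.25;
KnafKuhlmann2005 by ramification theory instead); a non-Abhyankar ν has an infinitely generated Γ
and the printed way out is to read ν as a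
LIMIT OF ABHYANKAR SEMIVALUATIONS carrying finite pieces of Γ and to transfer their toric
uniformizations (Teissier2023 p.5; Teissier2014
§10). Imported areas: valuation theory of semigroups and key polynomials (CutkoskyTeissier2008,
Spivakovsky1990, FavreJonsson2004 — in
dimension 2 the shadows are the key-polynomial curve semivaluations of the valuative tree), toric
geometry of binomial varieties
(González Pérez–Teissier), Kaplansky–Hahn generalized power series (Kedlaya2001) as the intended
engine for K1 in rank one (shadows =
truncations of the transfinite arc of ν), and the 2026 tight-extension theorem (HOST2026) that lets
completion be used without losing
algebraicity. What it does that the 26 open routes do not: the four valuation routes uniformize by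
α_p-torsors/defect (Valuative),
Artin–Schreier ascent (CyclicCovers), Néron–Popescu ind-smoothness (IndSmooth) or p-closed
derivations (FoliationDescent) — none uses the
value SEMIGROUP, gr_ν R or a toric endpoint; TropicalLinks has the toric endpoint but globally
(schön very affine opens, Gröbner fans, no
valuations, no patching) — here the object is one valuation at a time and the new move is
semivaluation approximation; patching (IndSmooth's
PatchingPerfect) and descent (0550/0549) are shared currency and declared as such; negatives index
empty.

RANKED CRUXES. #0 LurelRational (target) — relative Zariski local uniformization for RATIONAL
valuation rings over algebraically closed ground fields of characteristic p: k algebraically closed,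
K/k finitely generated, O a valuation ring of K containing k with every element of O congruent to a
constant modulo the maximal ideal, R ⊆ O finitely generated ⇒ some finitely generated A with R ⊆ A ⊆
O, Frac A = K, A regular at the centre of O. (= Valuative's LUrel / IndSmooth's LurelPerfect
restricted to rational O over k̄; by RationalSuffices nothing is lost over k̄.) (why it might fail:
it is local uniformization in characteristic p at the zero-dimensional valuations, where all the
difficulty sits (tree LocalUniformizationClosedPoints); open from trdeg 4; fails only with the
summit (tree ResolutionInChar.relLocalUniformization).) [Teissier2014, Temkin2013,
NovacoskiSpivakovsky2014, CutkoskyMourtada2019]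
#2 ShadowsUniformize (crux) — TRANSFER (Teissier's conjecture, second half, typed): k algebraically
closed of char p, K/k f.g., O rational valuation ring over k, R ⊆ O f.g.; IF for every finite F ⊆ R
there is a shadow of (R, O) exact on F — a local blowing up R ≤ R₁ ⊆ O (f.g., Frac R₁ = K), a field
L, a k-algebra map φ : R₁ → L and a valuation ring O' of L with: rational rank of O' = rational rank
of O, φ(R₁) ⊆ O', same centre (ν'(φy) < 1 ↔ ν(y) < 1), O' rational, the value semigroup of ν' on
φ(R₁) finitely generated, and an injective ordered hom ι of value groups with ι(ν'(φ(R₁))) inside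
the value semigroup of ν on R₁ and ι ∘ ν' ∘ φ = ν on F — THEN R is dominated by a finitely generated
A ⊆ O with Frac A = K, regular at the centre. Proof plan: overweight deformation of the shadow to
Spec k[t^Γ'] (Teissier2014 Thm 3.12), regular fan uniformizing ν' (Thm 4.3), the same monomial
blow-up in lifted generators applied to R₁, algebraisation by tight extension (HOST2026 Thm 1.1);
the case φ injective (Abhyankar O) is Teissier2014 Cor 6.25. [difficulty: open-problem] (why it
might fail: the fan uniformizing a shadow is blind to the tail of ν beyond F: defect/kangaroo may
force ever finer fans as F grows, so no finite F suffices (Teissier2023 p.5 states the transfer only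
for his canonical nested K_α; HOST2012 Conj 9.1, a cousin, fell to Cutkosky 2019 Thm 1.5/1.6).)
[Teissier2014, Teissier2023, HOST2026, HOST2012, CutkoskyTeissier2008,
Literature.Barriers.ResolutionOfSingularities.Hauser2003_kangarooShadeIncrease]
#3 SemivaluationShadows (crux) — EXISTENCE (Teissier's conjecture, first half, typed over finite
sets): for k algebraically closed of char p, K/k f.g., O a rational valuation ring over k and R ⊆ O
f.g., every finite F ⊆ R admits a shadow of (R, O) exact on F in the sense of crux 2 (local blowing
up R₁; field L; φ : R₁ →ₐ[k] L; O' rational of the same rational rank with f.g. value semigroup on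
φ(R₁), same centre, value-group embedding ι into the semigroup of ν, ι ∘ ν' ∘ φ = ν on F). Known
anchors: O Abhyankar ⇒ φ = id works after a ν-modification (quasi-finite generation, Teissier2014
Thm 6.21/Cor 6.22 + Prop 'Abext'); dim R = 2 ⇒ key-polynomial curve semivaluations (Spivakovsky1990
§8, FavreJonsson2004 Ch. 3); intended engine in rank one: truncations of the Kaplansky–Hahn
transfinite arc of ν (Kedlaya2001) and a Hasse-derivative continuity lemma. [difficulty:
open-problem] (why it might fail: in dim ≥ 3 generating sequences of rank-one valuations are wild
(CutkoskyTeissier2008 §§4–6; Cutkosky 2019): a transcendental Hahn arc whose supports accumulate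
(the defect signature) may admit no curve through the centre matching ν on a prescribed F with its
whole semigroup inside Γ.) [Teissier2023, Teissier2014, CutkoskyTeissier2008, Spivakovsky1990,
FavreJonsson2004, Kedlaya2001,
Literature.Barriers.ResolutionOfSingularities.ArtinSchreierPuiseuxNarrow]
#4 PatchingPerfect (crux) — (shared VERBATIM with route IndSmooth) ZARISKI PATCHING OVER ONE PERFECT
FIELD: for k perfect of characteristic p, relative local uniformization for all finitely generated
K/k implies that every reduced separated k-scheme of finite type has a resolution; the tree proves
its reduction to Piltant's two-model patching (resolutionOverUpToDim_of_twoModelPatching_of_relLU),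
used here at algebraically closed k. [difficulty: open-problem] (why it might fail: = two-model
patching (Piltant2013 Prop 5.1 for P_reg): known in dim ≤ 3 only (Zariski 1944; CossartPiltant2008
Prop 4.9), open as an implication in dim ≥ 4 even in characteristic 0 (CutkoskyMourtada2019 p.3).)
[Piltant2013, CossartPiltant2019, CutkoskyMourtada2019,
Literature.Barriers.ResolutionOfSingularities.DimensionFourFrontier]
#5 DescentAlgclosedToPerfect (crux) — (stmt-0550 VERBATIM, shared with routes Descent /
TropicalLinks / UniformComplexity) for a prime p, resolution of all reduced separated finite-type
schemes over all ALGEBRAICALLY CLOSED fields of char p implies the same over all PERFECT fields of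
char p. [difficulty: M] (why it might fail: print gets k̄ ⇒ perfect k only for Galois-EQUIVARIANT
resolutions (Kollar2007 Thm 3.36); a toric uniformization of a shadow is canonical in the fan but
the shadows are chosen, so a Gal-stable choice is needed — false if some X/F_q has no Gal-stable
resolution.) [Kollar2007, arXiv:1206.3090,
Literature.Barriers.ResolutionOfSingularities.InseparableBaseChange]
#6 DescentPerfectToAll (crux) — (stmt-0549 VERBATIM, shared with routes Descent / WeightedInvariant
/ IndSmooth / …) for a prime p, resolution of all reduced separated finite-type schemes over all
PERFECT fields of characteristic p implies ResolutionInChar p. [difficulty: L] (why it might fail: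
regular is not geometrically regular under inseparable ground-field extension (EGA IV 6.7.4);
spreading out needs k/K0 separable, impossible when X needs more than p-rank(k) parameters (k =
F_p((t))).) [arXiv:math/0703678, CossartPiltant2009,
Literature.Barriers.ResolutionOfSingularities.InseparableBaseChange,
Literature.Barriers.ResolutionOfSingularities.RegularNotGeometricallyRegular]
#9 RationalSuffices (support) — over an algebraically closed field k of characteristic p, relative
local uniformization for RATIONAL valuation rings (every element of O congruent to a constant of k
modulo the maximal ideal) of all finitely generated K/k implies it for ALL valuation rings over k —
the exact hypothesis shape of PatchingPerfect at k. Proof: the tree's relLU_of_relLU_zeroDim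
(LocalUniformizationClosedPoints.lean: closed points of the Zariski–Riemann space suffice; Serre +
Zariski's lemma) and, over k̄, zero-dimensional = rational (a non-zero f ∈ k[T] with f(x) a non-unit
splits into linear factors, one of which is a non-unit). [difficulty: provable-now]
[ZariskiSamuel1960, CossartPiltant2019, Teissier2014]

TWO-LAYER PLAN. Foreseen glued splits (nothing filed now). SemivaluationShadows ⇐ HahnArcShadows
(rank one: embed (K, ν) into the Hahn field k((t^ℚ))
(Kaplansky; residue field k̄, divisible hull of the value group), truncate the transfinite arc x_i ↦
x_i(t) at ordinal positions — finite
supports are algebraic over k((t)), so the truncated substitution has a one-dimensional image: a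
curve shadow with numerical semigroup — and
prove exactness on F by a Hasse–Schmidt Taylor estimate f(x) − f(x_≤m) = Σ_k ∂^[k]f(x_≤m)(x −
x_≤m)^k along the accumulation points of
the supports) → HigherRankShadows (compose along the finitely many overrings, tree
CompositeValuations) → SemivaluationShadows; for
rational rank r ≥ 2 the arc is replaced by an r-dimensional monomial-by-transcendental map.
ShadowsUniformize ⇐ ShadowFanTransfer (formal:
a regular fan uniformizing the overweight shadow uniformizes R̂₁ at the point picked by ν once F
contains lifts of the fan's ray generators
and the overweight witnesses) → TightAlgebraisation (HOST2026 Thm 1.1 + excellence: the monomial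
blow-up and regularity descend from R̂₁/H
to R₁, as in the proof of Teissier2014 Cor 6.25) → ShadowsUniformize. PatchingPerfect ⇐
TwoModelPatchingPerfect (Piltant Prop 5.1, P_reg)
→ the proved tree reduction → PatchingPerfect (shared with IndSmooth / Valuative's PatchingRel
lines).

KILL CRITERIA. ¬SemivaluationShadows for ONE explicit rational valuation (e.g. a Kedlaya-type
transcendental Hahn arc on k[x,y,z] with an accumulating
support, or the valuation of a Cutkosky–Teissier semigroup example) refutes Teissier's conjecture in
this typing and closes the route
`refuted:SemivaluationShadows` — unless the witness only defeats exactness on F for shadows of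
dimension EXACTLY r, in which case restate
with rational rank ≥ (one repair, then close). ¬ShadowsUniformize (shadows exist but no finite F
transfers) kills the line outright:
close `refuted:ShadowsUniformize`, record the witness as a barrier note "toric shadows are
tail-blind" for TropicalLinks and arcs-see-the-
differential. ¬PatchingPerfect kills every LU route at once (shared core). LUrel (Valuative 0639) or
LurelPerfect (IndSmooth) proved
elsewhere moots cruxes 2–3 (close superseded --by that route); resolution over perfect fields proved
elsewhere moots 2–4.

NOT DECOMPOSED YET. The rank-one Hahn-arc engine and the higher-rank composition (children of
SemivaluationShadows); the formal transfer lemma and its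
algebraisation (children of ShadowsUniformize); the vendoring of Teissier2014 Thm 3.12 / 4.3 / 6.21
and HOST2026 Thm 1.1 as Literature
named facts (Literature work, not items: overweight deformations, gr_ν R ≅ k[t^Γ] for rational ν,
tight extensions); the two-model
patching core (shared). All are layer-2 children, filed when a crux closes or a prover proposes the
split.

CHEAPEST FALSIFIER. Run this session (lookups): (i) already refuted? Teissier2023 p.6 reports
Cutkosky 2019 Thm 1.5/1.6 refuting ONLY the stronger HOST2012
Conj 9.1 (equal semigroups of R′ and R̂′/H′) and restates the semivaluation conjecture as open;
HOST2026 (Aug 2026) calls it a live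
approach. (ii) K1 vacuous/trivial? φ = id, O' = O needs a finitely generated semigroup on R₁, which
for rational ν forces Abhyankar
(Teissier2014 p.4 + Thm 6.21): off the known case every shadow has a kernel or is formal; the
trivial shadow (φ onto k) dies as soon as F
holds a non-zero element of the centre. (iii) K2 known? Only for Abhyankar O (Cor 6.25) and trdeg ≤
3 (CossartPiltant). Next cheapest
kill (kit-sized, not run): p = 2, 3; ν on k[x,y,z] from the Hahn arc x = t, y = Σ_i c_i t^(2−1/p^i),
z generic; MacLane keys up to degree
p², truncation-curve shadows for F = {x, y, z, φ_2, φ_3}; Macaulay2: does the regular fan resolving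
the shadow's monomial curve leave the
strict transform of the graph embedding of A³ regular at the centre of ν?

NUMBERS. Known: LU / resolution in dim ≤ 3, all p (CossartPiltant2008/2009/2019, in tree); LU of
Abhyankar valuations in every characteristic
(KnafKuhlmann2005; Teissier2014 Cor 6.25; Cutkosky2022 with simultaneity), i.e. K1 ∧ K2 at rational
rank = dim; one-toric-morphism
resolution after re-embedding for all reduced curve singularities (de Felipe–González Pérez–Mourtada
arXiv:2110.11276) = the shadows'
own resolution in rank one; tight extensions: rank one (HOST2012 / Teissier2014 §5), Abhyankar
(Teissier2014 Prop 5.1 'Abext'), ALL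
ranks (HOST2026 Thm 1.1, 2026). Dimension 2: every valuation of k(x,y) centred at a regular point is
a limit of curve semivaluations
with nested numerical semigroups (Spivakovsky1990; FavreJonsson2004). Items at open: 8 (target, 5
cruxes of which 3 shared, 1 support,
assembly).

DEFINITION REQUESTS. None for the items: everything is typed over Mathlib (ValuationSubring,
ValuationSubring.valuation / ValueGroup, Subalgebra.FG,
IntermediateField.FG, AlgHom, OrderMonoidWithZeroHom, MonoidHom.mrange, Submonoid.FG, Module.finrank
ℤ (Additive Γˣ) = rational rank,
IsRegularLocalRing, Localization.AtPrime) and the Statement's module. Facts a Literature seat may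
vendor for the provers of cruxes 2–3:
Teissier2014 Thm 3.12 (valuative Cohen theorem), Thm 4.3 (toric uniformization from finitely
generated gr), Thm 6.21 (quasi-finite
generation ⟺ Abhyankar), HOST2026 Thm 1.1 (tight extensions), CutkoskyTeissier2008 (no accumulation
of values in rank one).

Novelty: Searches (2026-08-16/17): `lit frontier ResolutionOfSingularities --since 2021` (60 rows; read
2602.06553, 2602.14266, 2606.12554,
2510.05765, 2605.22046, 2307.00416 — none on semigroup/toric LU); `lit search --source arxiv` × 12
("resolution singularities positive
characteristic" 8 → Teissier2023, MourtadaSchober 2502.01239, Bérczi; "local uniformization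
valuation characteristic" 6 → HOST2026 =
2607.11223 (the trigger), Teissier2023; "defect valuation extension" 4; "Artin-Schreier defect" 6 →
NartNovacoski 2503.18827, Cutkosky
2302.07710; "key polynomials valuation" 3; "purely inseparable alteration" 0; "wild quotient
singularities" 4; "Macaulayfication" 2;
"kangaroo characteristic" 1); `lit read` of arXiv:2311.12456 pp.1–6 + refs, arXiv:2607.11223 pp.1–3
+ refs, arXiv:1401.5204 Thm 4.3 /
6.21–6.27 / §10, arXiv:2502.01239 §§1–3, arXiv:2602.06553 Conj 1–2, arXiv:2503.18827 Conj 4.1; `lit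
galaxy search --star all` for
"overweight deformation" (4: LNM 2313 = Teissier2023 in print, CRM abstracts 2016, Campillo
Festschrift, CJS LNM 2270), "Abhyankar
semivaluation" (1: LNM 2313), "torific embedding" (1); in-book search of LNM 2313
(panama:449210629488656) confirming the conjecture's
text; ledger: the 26 route files (none mentions gr_ν, value semigroups or semivaluations;
TropicalLinks/IndSmooth/EquisingularLift/
SharpStrata cite Teissier only for overweight lifts, the torific Question or Teissier
singularities), 88 open + closed cards (related:
arcs-see-the-differential = Mourtada  [refs: 2311.12456, 2607.11223, 1401.5204, 2502.01239, 2602.06553, 2503.18827, Teissier2023, HOST2026, Teissier2014]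

Barriers (technique_class: semivaluation-approximation toric-uniformization): - technique_class: semivaluation-approximation toric-uniformization
- Literature.Barriers.ResolutionOfSingularities.Hauser2003_kangarooShadeIncrease: refutes order /
residual-order bookkeeping along blow-up SEQUENCES; evaded in object — no invariant, no sequence:
each shadow is uniformized by ONE regular fan read off a finitely generated semigroup
(characteristic-blind combinatorics); conceded that the same phenomenon can resurface as
tail-blindness in ShadowsUniformize (its why-it-might-fail), which is where the route would die
informatively.
- Literature.Barriers.ResolutionOfSingularities.hauserPerlega_mohProofBoundFails: same class
(Hauser–Perlega unbounded residual order, HauserPerlega2019); not used — no residual order is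
defined; the bet is that semigroup data of shadows, not orders of coefficients, control the fan.
- Literature.Barriers.ResolutionOfSingularities.ArtinSchreierPuiseuxNarrow: no Puiseux
parametrisation in char p (Chevalley's y^p − y = x⁻¹); evaded by working in the Hahn field k((t^ℚ))
with well-ordered supports (Kaplansky, Kedlaya2001), where every rank-one rational valuation over k̄
IS a transfinite arc; the defect shows as accumulation points of supports and is faced head-on in
K1's engine rather than assumed away.
- Literature.Barriers.ResolutionOfSingularities.Cutkosky2014: Cutkosky2014 (no monomialisation of
extensions R → S along a valuation in char p) is not invoked — the transfer modifies ONE ring R₁ by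
a monomial blow-up in lifted semigroup gener

History (route lifecycle, newest last):
- 2026-08-25T17:26:44Z · DORMANT — reconciler: no traction for 7.9 d (last activity item-evidence-added at 2026-08-17T19:19:21Z); parked, not closed — `ledger route dormant route-ResolutionOfSing (operator:999:2146672)
- 2026-08-26T17:00:01Z · REACTIVATED — reconciler: reactivated — activity statement-claimed at 2026-08-26T16:25:04Z after parking at 2026-08-25T17:26:44Z (operator:999:3448659)

sub-problem: ResolutionOfSingularities · status: open · opened planner-plan-novel-ResolutionOfSingularities-Re-dc19aa3a-a-v2-g15-0 2026-08-17T00:14:51Z · rev 1 · ledger route-ResolutionOfSingularities-AbhyankarShadows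
GENERATED by the gate from the ledger (D-0016/17). Provers cite these decls: `theorem foo : Summit.ResolutionOfSingularities.ResolutionOfSingularities.Theses.AbhyankarShadows.<Decl> := …` in Summits/ResolutionOfSingularities/ResolutionOfSingularities/Theorems/<Name>.lean.
-/

namespace Summit.ResolutionOfSingularities.ResolutionOfSingularities.Theses.AbhyankarShadows

open scoped BigOperators Topology Manifold Classical MeasureTheory ProbabilityTheory Matrix InnerProductSpace ComplexConjugate ContinuousMap
open Filter Set Function TopologicalSpace MeasureTheory

attribute [summit_statement] _root_.ResolutionOfSingularities

/-- item stmt-ResolutionOfSingularities-16755 · target · rank 0 · open · by planner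
why it might fail: it is local uniformization in characteristic p at the zero-dimensional valuations, where all the difficulty sits (tree LocalUniformizationClosedPoints); open from trdeg 4; fails only with the summit (tree ResolutionInChar.relLocalUniformization).
sources: Teissier2014, Temkin2013, NovacoskiSpivakovsky2014, CutkoskyMourtada2019
[target] relative Zariski local uniformization for RATIONAL valuation rings over algebraically
closed ground fields of characteristic p: k algebraically closed, K/k finitely generated, O a
valuation ring of K containing k with every element of O congruent to a constant modulo the maximal
ideal, R ⊆ O finitely generated ⇒ some finitely generated A with R ⊆ A ⊆ O, Frac A = K, A regular at
the centre of O. (= Valuative's LUrel / IndSmooth's LurelPerfect restricted to rational O over k̄;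
by RationalSuffices nothing is lost over k̄.) -/
@[route_item "route-ResolutionOfSingularities-AbhyankarShadows"]
def LurelRational : Prop :=
  ∀ p : ℕ, p.Prime → ∀ (k K : Type) [Field k] [CharP k p] [IsAlgClosed k] [Field K] [Algebra k K], (⊤ : IntermediateField k K).FG → ∀ O : ValuationSubring K, (∀ c : k, algebraMap k K c ∈ O) → (∀ x : K, x ∈ O → ∃ c : k, O.valuation (x - algebraMap k K c) < 1) → ∀ R : Subalgebra k K, R.FG → R.toSubring ≤ O.toSubring → ∃ (A : Subalgebra k K) (h : A.toSubring ≤ O.toSubring), R ≤ A ∧ A.FG ∧ IsFractionRing A K ∧ IsRegularLocalRing (Localization.AtPrime (Ideal.comap (Subring.inclusion h) (IsLocalRing.maximalIdeal O)))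

/-- item stmt-ResolutionOfSingularities-16756 · crux · rank 2 · open · by planner
why it might fail: the fan uniformizing a shadow is blind to the tail of ν beyond F: defect/kangaroo may force ever finer fans as F grows, so no finite F suffices (Teissier2023 p.5 states the transfer only for his canonical nested K_α; HOST2012 Conj 9.1, a cousin, fell to Cutkosky 2019 Thm 1.5/1.6).
sources: Teissier2014, Teissier2023, HOST2026, HOST2012, CutkoskyTeissier2008, Literature.Barriers.ResolutionOfSingularities.Hauser2003_kangarooShadeIncrease
[crux] TRANSFER (Teissier's conjecture, second half, typed): k algebraically closed of char p, K/k
f.g., O rational valuation ring over k, R ⊆ O f.g.; IF for every finite F ⊆ R there is a shadow of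
(R, O) exact on F — a local blowing up R ≤ R₁ ⊆ O (f.g., Frac R₁ = K), a field L, a k-algebra map φ
: R₁ → L and a valuation ring O' of L with: rational rank of O' = rational rank of O, φ(R₁) ⊆ O',
same centre (ν'(φy) < 1 ↔ ν(y) < 1), O' rational, the value semigroup of ν' on φ(R₁) finitely
generated, and an injective ordered hom ι of value groups with ι(ν'(φ(R₁))) inside the value
semigroup of ν on R₁ and ι ∘ ν' ∘ φ = ν on F — THEN R is dominated by a finitely generated A ⊆ O
with Frac A = K, regular at the centre. Proof plan: overweight deformation of the shadow to Spec
k[t^Γ'] (Teissier2014 Thm 3.12), regular fan uniformizing ν' (Thm 4.3), the same monomial blow-up in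
lifted generators applied to R₁, algebraisation by tight extension (HOST2026 Thm 1.1); the case φ
injective (Abhyankar O) is Teissier2014 Cor 6.25. [difficulty: open-problem] -/
@[route_item "route-ResolutionOfSingularities-AbhyankarShadows", crux]
def ShadowsUniformize : Prop :=
  ∀ p : ℕ, p.Prime → ∀ (k K : Type) [Field k] [CharP k p] [IsAlgClosed k] [Field K] [Algebra k K], (⊤ : IntermediateField k K).FG → ∀ O : ValuationSubring K, (∀ c : k, algebraMap k K c ∈ O) → (∀ x : K, x ∈ O → ∃ c : k, O.valuation (x - algebraMap k K c) < 1) → ∀ R : Subalgebra k K, R.FG → R.toSubring ≤ O.toSubring → (∀ F : Finset R, ∃ (R₁ : Subalgebra k K) (hle : R ≤ R₁) (_ : R₁.toSubring ≤ O.toSubring), R₁.FG ∧ IsFractionRing R₁ K ∧ ∃ (L : Type) (_ : Field L) (_ : Algebra k L) (φ : R₁ →ₐ[k] L) (O' : ValuationSubring L), Module.finrank ℤ (Additive (O'.ValueGroup)ˣ) = Module.finrank ℤ (Additive (O.ValueGroup)ˣ) ∧ (∀ y : R₁, φ y ∈ O') ∧ (∀ y : R₁, O'.valuation (φ y) < 1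 ↔ O.valuation (y : K) < 1) ∧ (∀ z : L, z ∈ O' → ∃ c : k, O'.valuation (z - algebraMap k L c) < 1) ∧ (MonoidHom.mrange (O'.valuation.toMonoidWithZeroHom.toMonoidHom.comp φ.toRingHom.toMonoidHom)).FG ∧ ∃ ι : O'.ValueGroup →*₀o O.ValueGroup, Function.Injective ι ∧ (∀ y : R₁, φ y ≠ 0 → ∃ y' : R₁, ι (O'.valuation (φ y)) = O.valuation (y' : K)) ∧ ∀ x ∈ F, ι (O'.valuation (φ (Subalgebra.inclusion hle x))) = O.valuation ((x : R) : K)) → ∃ (A : Subalgebra k K) (h : A.toSubring ≤ O.toSubring), R ≤ A ∧ A.FG ∧ IsFractionRing A K ∧ IsRegularLocalRing (Localization.AtPrime (Ideal.comap (Subring.inclusion h) (IsLocalRing.maximalIdeal O)))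

/-- item stmt-ResolutionOfSingularities-16757 · crux · rank 3 · open · by planner
why it might fail: in dim ≥ 3 generating sequences of rank-one valuations are wild (CutkoskyTeissier2008 §§4–6; Cutkosky 2019): a transcendental Hahn arc whose supports accumulate (the defect signature) may admit no curve through the centre matching ν on a prescribed F with its whole semigroup inside Γ.
sources: Teissier2023, Teissier2014, CutkoskyTeissier2008, Spivakovsky1990, FavreJonsson2004, Kedlaya2001
[crux] EXISTENCE (Teissier's conjecture, first half, typed over finite sets): for k algebraically
closed of char p, K/k f.g., O a rational valuation ring over k and R ⊆ O f.g., every finite F ⊆ R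
admits a shadow of (R, O) exact on F in the sense of crux 2 (local blowing up R₁; field L; φ : R₁
→ₐ[k] L; O' rational of the same rational rank with f.g. value semigroup on φ(R₁), same centre,
value-group embedding ι into the semigroup of ν, ι ∘ ν' ∘ φ = ν on F). Known anchors: O Abhyankar ⇒
φ = id works after a ν-modification (quasi-finite generation, Teissier2014 Thm 6.21/Cor 6.22 + Prop
'Abext'); dim R = 2 ⇒ key-polynomial curve semivaluations (Spivakovsky1990 §8, FavreJonsson2004 Ch.
3); intended engine in rank one: truncations of the Kaplansky–Hahn transfinite arc of ν
(Kedlaya2001) and a Hasse-derivative continuity lemma. [difficulty: open-problem] -/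
@[route_item "route-ResolutionOfSingularities-AbhyankarShadows", crux]
def SemivaluationShadows : Prop :=
  ∀ p : ℕ, p.Prime → ∀ (k K : Type) [Field k] [CharP k p] [IsAlgClosed k] [Field K] [Algebra k K], (⊤ : IntermediateField k K).FG → ∀ O : ValuationSubring K, (∀ c : k, algebraMap k K c ∈ O) → (∀ x : K, x ∈ O → ∃ c : k, O.valuation (x - algebraMap k K c) < 1) → ∀ R : Subalgebra k K, R.FG → R.toSubring ≤ O.toSubring → ∀ F : Finset R, ∃ (R₁ : Subalgebra k K) (hle : R ≤ R₁) (_ : R₁.toSubring ≤ O.toSubring), R₁.FG ∧ IsFractionRing R₁ K ∧ ∃ (L : Type) (_ : Field L) (_ : Algebra k L) (φ : R₁ →ₐ[k] L) (O' : ValuationSubring L), Module.finrank ℤ (Additive (O'.ValueGroup)ˣ) = Module.finrank ℤ (Additive (O.ValueGroup)ˣ) ∧ (∀ y : R₁, φ y ∈ O') ∧ (∀ y : R₁, O'.valuation (φ y) < 1 ↔ O.valuation (y : K) < 1) ∧ (∀ z : L, z ∈ O' → ∃ c : k, O'.valuation (z - algebraMap k L c) < 1) ∧ (MonoidHom.mrange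 (O'.valuation.toMonoidWithZeroHom.toMonoidHom.comp φ.toRingHom.toMonoidHom)).FG ∧ ∃ ι : O'.ValueGroup →*₀o O.ValueGroup, Function.Injective ι ∧ (∀ y : R₁, φ y ≠ 0 → ∃ y' : R₁, ι (O'.valuation (φ y)) = O.valuation (y' : K)) ∧ ∀ x ∈ F, ι (O'.valuation (φ (Subalgebra.inclusion hle x))) = O.valuation ((x : R) : K)

/-- item stmt-ResolutionOfSingularities-16089 · crux · rank 4 · open · by planner
why it might fail: = two-model patching (Piltant2013 Prop 5.1 for P_reg): known in dim ≤ 3 only (Zariski 1944; CossartPiltant2008 Prop 4.9), open as an implication in dim ≥ 4 even in characteristic 0 (CutkoskyMourtada2019 p.3).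
sources: Piltant2013, CossartPiltant2019, CutkoskyMourtada2019, Literature.Barriers.ResolutionOfSingularities.DimensionFourFrontier
[crux] ZARISKI PATCHING OVER ONE PERFECT FIELD: for k perfect of characteristic p, relative local
uniformization for all finitely generated fields K/k (LurelPerfect at k) implies that every reduced
separated k-scheme of finite type has a resolution. The tree PROVES the reduction to Piltant's
two-model patching of projective models over k
(Literature.AlgebraicGeometry.Resolution.resolutionOverUpToDim_of_twoModelPatching_of_relLU with
exists_topologicalKrullDim_le_of_locallyOfFiniteType), so the open content is exactly: any two
projective models M₁, M₂ of K/k are dominated by a third N with φᵢ⁻¹(Reg Mᵢ) ⊆ Reg N (Piltant2013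
Prop 5.1, P = P_reg) over perfect k. [difficulty: open-problem] -/
@[route_item "route-ResolutionOfSingularities-AbhyankarShadows", crux]
def PatchingPerfect : Prop :=
  ∀ p : ℕ, p.Prime → ∀ (k : Type) [Field k] [CharP k p] [PerfectField k], (∀ (K : Type) [Field K] [Algebra k K], (⊤ : IntermediateField k K).FG → ∀ O : ValuationSubring K, (∀ c : k, algebraMap k K c ∈ O) → ∀ R : Subalgebra k K, R.FG → R.toSubring ≤ O.toSubring → ∃ (A : Subalgebra k K) (h : A.toSubring ≤ O.toSubring), R ≤ A ∧ A.FG ∧ IsFractionRing A K ∧ IsRegularLocalRing (Localization.AtPrime (Ideal.comap (Subring.inclusion h) (IsLocalRing.maximalIdeal O)))) → ∀ (X : AlgebraicGeometry.Scheme.{0}) (f : X ⟶ AlgebraicGeometry.Spec (.of k)), AlgebraicGeometry.IsSeparated f → AlgebraicGeometry.LocallyOfFiniteType f → AlgebraicGeometry.QuasiCompact f → AlgebraicGeometry.IsReduced X → Literature.AlgebraicGeometry.Resolution.Scheme.HasResolution X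

/-- item stmt-ResolutionOfSingularities-0550 · crux · rank 5 · open · by planner
why it might fail: print gets k̄ ⇒ perfect k only for Galois-EQUIVARIANT resolutions (Kollar2007 Thm 3.36); a toric uniformization of a shadow is canonical in the fan but the shadows are chosen, so a Gal-stable choice is needed — false if some X/F_q has no Gal-stable resolution.
sources: Kollar2007, arXiv:1206.3090, Literature.Barriers.ResolutionOfSingularities.InseparableBaseChange
AlgClosedToPerfect: for a prime p, resolution of all reduced separated finite-type schemes over all
ALGEBRAICALLY CLOSED fields of char p implies the same over all PERFECT fields of char p. Needs
Galois descent of some resolution (a Gal-invariant one), i.e. a canonicity input, or a trick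
avoiding it. -/
@[route_item "route-ResolutionOfSingularities-AbhyankarShadows", crux]
def DescentAlgclosedToPerfect : Prop :=
  ∀ p : ℕ, p.Prime → (∀ (k : Type) [Field k] [CharP k p] [IsAlgClosed k] (X : AlgebraicGeometry.Scheme.{0}) (f : X ⟶ AlgebraicGeometry.Spec (.of k)), AlgebraicGeometry.IsSeparated f → AlgebraicGeometry.LocallyOfFiniteType f → AlgebraicGeometry.QuasiCompact f → AlgebraicGeometry.IsReduced X → Literature.AlgebraicGeometry.Resolution.Scheme.HasResolution X) → ∀ (k : Type) [Field k] [CharP k p] [PerfectField k] (X : AlgebraicGeometry.Scheme.{0}) (f : X ⟶ AlgebraicGeometry.Spec (.of k)), AlgebraicGeometry.IsSeparated f → AlgebraicGeometry.LocallyOfFiniteType f → AlgebraicGeometry.QuasiCompact f → AlgebraicGeometry.IsReduced X → Literature.AlgebraicGeometry.Resolution.Scheme.HasResolution X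

/-- item stmt-ResolutionOfSingularities-0549 · crux · rank 6 · open · by planner
why it might fail: regular is not geometrically regular under inseparable ground-field extension (EGA IV 6.7.4); spreading out needs k/K0 separable, impossible when X needs more than p-rank(k) parameters (k = F_p((t))).
sources: arXiv:math/0703678, CossartPiltant2009, Literature.Barriers.ResolutionOfSingularities.InseparableBaseChange, Literature.Barriers.ResolutionOfSingularities.RegularNotGeometricallyRegular
PerfectToAll: for a prime p, resolution of all reduced separated finite-type schemes over all
PERFECT fields of char p implies ResolutionInChar p (all fields of char p). Expected inputs:
Neron-Popescu (Stacks 07GC), spreading out, openness of regular locus on excellent schemes;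
regularity is not stable under inseparable ground field extension, which is the difficulty. -/
@[route_item "route-ResolutionOfSingularities-AbhyankarShadows", crux]
def DescentPerfectToAll : Prop :=
  ∀ p : ℕ, p.Prime → (∀ (k : Type) [Field k] [CharP k p] [PerfectField k] (X : AlgebraicGeometry.Scheme.{0}) (f : X ⟶ AlgebraicGeometry.Spec (.of k)), AlgebraicGeometry.IsSeparated f → AlgebraicGeometry.LocallyOfFiniteType f → AlgebraicGeometry.QuasiCompact f → AlgebraicGeometry.IsReduced X → Literature.AlgebraicGeometry.Resolution.Scheme.HasResolution X) → Literature.AlgebraicGeometry.Resolution.ResolutionInChar.{0} p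

/-- item stmt-ResolutionOfSingularities-16758 · support · rank 9 · closed · proved by Summit.ResolutionOfSingularities.ResolutionOfSingularities.Theorems.rationalSuffices_proof @ 3b72cfe7c372 (prover) · by planner
sources: ZariskiSamuel1960, CossartPiltant2019, Teissier2014
[support] over an algebraically closed field k of characteristic p, relative local uniformization
for RATIONAL valuation rings (every element of O congruent to a constant of k modulo the maximal
ideal) of all finitely generated K/k implies it for ALL valuation rings over k — the exact
hypothesis shape of PatchingPerfect at k. Proof: the tree's relLU_of_relLU_zeroDim
(LocalUniformizationClosedPoints.lean: closed points of the Zariski–Riemann space suffice; Serre +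
Zariski's lemma) and, over k̄, zero-dimensional = rational (a non-zero f ∈ k[T] with f(x) a non-unit
splits into linear factors, one of which is a non-unit). [difficulty: provable-now] -/
@[route_item "route-ResolutionOfSingularities-AbhyankarShadows", crux]
def RationalSuffices : Prop :=
  ∀ p : ℕ, p.Prime → ∀ (k : Type) [Field k] [CharP k p] [IsAlgClosed k], (∀ (K : Type) [Field K] [Algebra k K], (⊤ : IntermediateField k K).FG → ∀ O : ValuationSubring K, (∀ c : k, algebraMap k K c ∈ O) → (∀ x : K, x ∈ O → ∃ c : k, O.valuation (x - algebraMap k K c) < 1) → ∀ R : Subalgebra k K, R.FG → R.toSubring ≤ O.toSubring → ∃ (A : Subalgebra k K) (h : A.toSubring ≤ O.toSubring), R ≤ A ∧ A.FG ∧ IsFractionRing A K ∧ IsRegularLocalRing (Localization.AtPrime (Ideal.comap (Subring.inclusion h) (IsLocalRing.maximalIdeal O)))) → ∀ (K : Type) [Field K] [Algebra k K], (⊤ : IntermediateField k K).FG → ∀ O : ValuationSubring K, (∀ c : k, algebraMap k K c ∈ O) → ∀ R : Subalgebra k K, R.FG → R.toSubring ≤ O.toSubring → ∃ (A : Subalgebra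 k K) (h : A.toSubring ≤ O.toSubring), R ≤ A ∧ A.FG ∧ IsFractionRing A K ∧ IsRegularLocalRing (Localization.AtPrime (Ideal.comap (Subring.inclusion h) (IsLocalRing.maximalIdeal O)))

-- `RationalSuffices` holds: proved by `Summit.ResolutionOfSingularities.ResolutionOfSingularities.Theorems.rationalSuffices_proof` @ 3b72cfe7c372 (its module imports this route file, so no `_holds` link can be stated here).

/-- item stmt-ResolutionOfSingularities-16759 · assembly · rank 1 · open · by planner
sources: Teissier2014, Piltant2013
[assembly] ShadowsUniformize → SemivaluationShadows → RationalSuffices → PatchingPerfect →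
DescentAlgclosedToPerfect → DescentPerfectToAll → ResolutionOfSingularities. -/
@[route_item "route-ResolutionOfSingularities-AbhyankarShadows"]
def Assembly : Prop :=
  ShadowsUniformize → SemivaluationShadows → RationalSuffices → PatchingPerfect → DescentAlgclosedToPerfect → DescentPerfectToAll → _root_.ResolutionOfSingularities

/-! D-0027 §2.1 — DECIDING THEOREM (planner-authored via `route open/edit --closes-file`; by planner-plan-novel-ResolutionOfSingularities-Re-dc19aa3a-a-v 2026-08-17T00:14:51Z):
its hypotheses are this route's items and its conclusion the sub-problem Statement (glue_lint), and it elaborates with this file. -/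

@[closes "route-ResolutionOfSingularities-AbhyankarShadows"] theorem closes (h1 : SemivaluationShadows) (h2 : ShadowsUniformize) (h3 : RationalSuffices)
    (hP : PatchingPerfect) (hD1 : DescentAlgclosedToPerfect) (hD2 : DescentPerfectToAll) :
    ResolutionOfSingularities := fun p hp =>
  hD2 p hp (hD1 p hp (fun k _ _ _ X f hs hl hq hr =>
    hP p hp k (h3 p hp k (fun K _ _ hfg O hO hrat R hR hRO =>
      h2 p hp k K hfg O hO hrat R hR hRO (fun F => h1 p hp k K hfg O hO hrat R hR hRO F))) X f hs hl hq hr))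

end Summit.ResolutionOfSingularities.ResolutionOfSingularities.Theses.AbhyankarShadows
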